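import Literature.NumberTheory.Automorphic.UnitaryGroupArchCharacterTraceClass
import Literature.Analysis.OperatorTheory.NuclearAlongHilbertBasis
import HarnessLib

/-!
# The trace-class letter for `(ϖ_x ∘ proj_ι)(φ)` REDUCED to nuclearity along one Hilbert basis (Knapp, Thm. 10.2: the shape its proof delivers)

Topic `NumberTheory/Automorphic`; namespace `Literature.NumberTheory.Automorphic.UnitaryGroup` (home of the letter ★ `ArchIntegratedOperatorTraceClass`, file
`UnitaryGroupArchCharacterTraceClass`).  Theorems only (no definition, no named fact, no instance, no `sorry`).  Cell `hodgecm-mathlib`, floor 0, programme P3,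
crux H413, line T1a `Cruxes/H413/Lines/F0_T1a_ArchCharactersLinIndep.lean` (stub `stub_traceClass` = letter A5, books row #91), road HC node H0′ (lead F0P3b-p01 (g2),
desk F0P3-plan (g6) «=» 2026-08-31T16:53:32Z).

THE REDUCTION.  The letter ★ `ArchIntegratedOperatorTraceClass L ι H T hT νinf` asks, for every Haar `νinf`, every `(𝔤, K)`-class `x` of `U(2,1)` with a unitary globalization
`ϖ` on `E`, and every continuous compactly supported archimedean-smooth `φ` on `G′_∞`, that `Op := (ϖ ∘ archProjUForm)(φ)` be Hilbert–Schmidt along EVERY Hilbert basis, with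
summable diagonal along EVERY Hilbert basis and a basis-free diagonal sum.  By ★ `Literature.Analysis.OperatorTheory.traceClass_clauses_of_summable_norm_apply` (node H0,
[ReedSimon1972, Thm. VI.18, VI.24]) all three clauses follow once `Op` is NUCLEAR ALONG ONE HILBERT BASIS: `Σ_k ‖Op e_k‖ < ∞` for SOME Hilbert basis `e` of `E`.  That is
precisely what Knapp's proof of [Knapp1986, Thm. 10.2] produces, along a basis `e` adapted to the `K`-isotypic decomposition `E = ⊕̂_τ E(τ)`:
`Σ_k ‖Op e_k‖ ≤ Σ_τ dim E(τ) · ‖Op|_{E(τ)}‖ ≤ ‖(1 + Ω_K)^N φ‖_{L¹} · Σ_τ m_x(τ) d(τ) (1 + c(τ))^{-N} < ∞` (finite `K`-multiplicities of the admissible class with polynomial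
growth [HarishChandra1954], the Casimir eigenvalue `c(τ)` on `E(τ)`, `N` large).  So after this file the letter's residual is ONE scalar estimate per `(ϖ, φ)`.

* `archIntegratedOperatorTraceClass_of_summable_norm_apply` — the letter from «for every `(hν, x, E, ϖ, hϖ, φ)` as in the letter there is a Hilbert basis `e` of `E` with
  `Summable (fun k => ‖Op (e k)‖)`».

HONEST LABEL: a reduction, not a discharge — nuclearity along an adapted basis (nodes H1–H5 of the line card, ED. 3) is NOT proved here; the letter A5 stays booked (#91).
HC_CM is proved only modulo the 2 remaining named inputs (hLiu418, h413) until rung 0 closes.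

## References
* A. W. Knapp, *Representation Theory of Semisimple Groups: An Overview Based on Examples* (1986), Thm. 10.2 and its proof (via Thm. 8.1) [Knapp1986].
* M. Reed, B. Simon, *Methods of Modern Mathematical Physics I* (1972), Thm. VI.18, VI.24 [ReedSimon1972].
* Harish-Chandra, *Representations of semisimple Lie groups. II*, Trans. AMS 76 (1954) (multiplicity bound `m(τ) ≤ dim τ`) [HarishChandra1954].
-/

set_option autoImplicit false

noncomputable section

open NumberField MeasureTheory CompactlySupported
open Literature.Analysis.OperatorTheory
-- `Classical`: the place subtypes indexing `mixedSpace L` are `Fintype` classically, as in ★ `UnitaryGroupArchCharacterTraceClass` (token-for-token binder match).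
open scoped Matrix InnerProductSpace ENNReal NNReal Classical

namespace Literature.NumberTheory.Automorphic.UnitaryGroup

open Literature.RepresentationTheory.KonnoKonno2007 Literature.RepresentationTheory.KonnoKonno2007.RealDualPair
open Literature.NumberTheory.Rogawski1990 (ArchTestKc)

variable (L : Type) [Field L] [NumberField L] [IsCMField L] (ι : L →+* ℂ) (H : Matrix (Fin 3) (Fin 3) L) (T : GL (Fin 3) ℂ)
  (hT : (T : Matrix (Fin 3) (Fin 3) ℂ)ᴴ * H.map ι * (T : Matrix (Fin 3) (Fin 3) ℂ) = Literature.Geometry.ComplexHyperbolic.BallModel.J)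

/-- **KNAPP THM. 10.2 FOR `G′_∞`, REDUCED TO NUCLEARITY ALONG ONE HILBERT BASIS**: if for every Haar `νinf`, every class `x` with unitary globalization `ϖ` on `E` and
every continuous compactly supported archimedean-smooth `φ` there is SOME Hilbert basis `e` of `E` with `Σ_k ‖(ϖ ∘ archProjUForm)(φ) (e k)‖ < ∞`, then the letter
★ `ArchIntegratedOperatorTraceClass L ι H T hT νinf` holds (Hilbert–Schmidt along every basis, summable diagonal, basis-free sum — by ★
`traceClass_clauses_of_summable_norm_apply`). [cite: Knapp1986, Thm. 10.2] [cite: ReedSimon1972, Thm. VI.18, VI.24] -/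
theorem archIntegratedOperatorTraceClass_of_summable_norm_apply
    (νinf : @Measure (arch (↥(maximalRealSubfield L)) L (IsCMField.complexConj L) 3 H) (borel _))
    (h : letI : MeasurableSpace (arch (↥(maximalRealSubfield L)) L (IsCMField.complexConj L) 3 H) := borel _
      haveI : BorelSpace (arch (↥(maximalRealSubfield L)) L (IsCMField.complexConj L) 3 H) := ⟨rfl⟩
      ∀ (_hν : νinf.IsHaarMeasure)
        (x : GKIrrClass (uFormGroup (Fin 2) (Fin 1)))
        (E : Type) [NormedAddCommGroup E] [InnerProductSpace ℂ E] [CompleteSpace E]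
        (ϖ : ContRepresentation ℂ (uFormGroup (Fin 2) (Fin 1)).carrier E) (hϖ : IsUnitaryGlobalization (uFormGroup (Fin 2) (Fin 1)) x ϖ)
        (φ : arch (↥(maximalRealSubfield L)) L (IsCMField.complexConj L) 3 H → ℂ) (hφc : Continuous φ) (hφs : HasCompactSupport φ),
        (∃ φ' : GL (Fin 3) (NumberField.mixedEmbedding.mixedSpace L) → ℂ, Continuous φ' ∧ HasCompactSupport φ' ∧
            IsArchSmooth (archGroupGL 3 L).carrier.subtype φ' ∧
            ∀ k : arch (↥(maximalRealSubfield L)) L (IsCMField.complexConj L) 3 H,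
              φ k = φ' (k : GL (Fin 3) (NumberField.mixedEmbedding.mixedSpace L))) →
        ∃ (κ₀ : Type) (e : HilbertBasis κ₀ ℂ E),
          Summable fun k => ‖(ϖ.restrict (archProjUForm L ι H T hT)).integratedOperator (hϖ.isUnitary.restrict _)
            (hϖ.isStronglyContinuous.restrict _ (continuous_archProjUForm L ι H T hT)) νinf ⟨⟨φ, hφc⟩, hφs⟩ (e k)‖) :
    ArchIntegratedOperatorTraceClass L ι H T hT νinf := by
  intro hν x E _ _ _ ϖ hϖ φ hφc hφs hφ' κ b
  obtain ⟨κ₀, e, he⟩ := h hν x E ϖ hϖ φ hφc hφs hφ'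
  exact traceClass_clauses_of_summable_norm_apply e _ he κ b

/-- **The same reduction, one representation and one test function at a time** (the form a node-by-node payer uses): at a Haar `νinf`, for a class `x` with unitary
globalization `ϖ` on `E` and a continuous compactly supported `φ`, nuclearity of `Op = (ϖ ∘ archProjUForm)(φ)` along one Hilbert basis gives the three trace-class
clauses of the letter for THIS `Op` along every Hilbert basis. [cite: Knapp1986, Thm. 10.2] [cite: ReedSimon1972, Thm. VI.18, VI.24] -/
theorem traceClass_clauses_integratedOperator_of_summable_norm_apply
    (νinf : @Measure (arch (↥(maximalRealSubfield L)) L (IsCMField.complexConj L) 3 H) (borel _)) :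
    letI : MeasurableSpace (arch (↥(maximalRealSubfield L)) L (IsCMField.complexConj L) 3 H) := borel _
    haveI : BorelSpace (arch (↥(maximalRealSubfield L)) L (IsCMField.complexConj L) 3 H) := ⟨rfl⟩
    ∀ (_hν : νinf.IsHaarMeasure)
      (x : GKIrrClass (uFormGroup (Fin 2) (Fin 1)))
      (E : Type) [NormedAddCommGroup E] [InnerProductSpace ℂ E] [CompleteSpace E]
      (ϖ : ContRepresentation ℂ (uFormGroup (Fin 2) (Fin 1)).carrier E) (hϖ : IsUnitaryGlobalization (uFormGroup (Fin 2) (Fin 1)) x ϖ)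
      (φ : arch (↥(maximalRealSubfield L)) L (IsCMField.complexConj L) 3 H → ℂ) (hφc : Continuous φ) (hφs : HasCompactSupport φ)
      (κ₀ : Type) (e : HilbertBasis κ₀ ℂ E),
      (Summable fun k => ‖(ϖ.restrict (archProjUForm L ι H T hT)).integratedOperator (hϖ.isUnitary.restrict _)
          (hϖ.isStronglyContinuous.restrict _ (continuous_archProjUForm L ι H T hT)) νinf ⟨⟨φ, hφc⟩, hφs⟩ (e k)‖) →
      ∀ (κ : Type) (b : HilbertBasis κ ℂ E),
        (∑' k, (‖(ϖ.restrict (archProjUForm L ι H T hT)).integratedOperator (hϖ.isUnitary.restrict _)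
            (hϖ.isStronglyContinuous.restrict _ (continuous_archProjUForm L ι H T hT)) νinf ⟨⟨φ, hφc⟩, hφs⟩ (b k)‖₊ : ℝ≥0∞) ^ 2 < ∞) ∧
        Summable (fun k => ⟪(b k : E), (ϖ.restrict (archProjUForm L ι H T hT)).integratedOperator (hϖ.isUnitary.restrict _)
            (hϖ.isStronglyContinuous.restrict _ (continuous_archProjUForm L ι H T hT)) νinf ⟨⟨φ, hφc⟩, hφs⟩ (b k)⟫_ℂ) ∧
        ∀ (κ' : Type) (b' : HilbertBasis κ' ℂ E),
          ∑' k, ⟪(b k : E), (ϖ.restrict (archProjUForm L ι H T hT)).integratedOperator (hϖ.isUnitary.restrict _)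
              (hϖ.isStronglyContinuous.restrict _ (continuous_archProjUForm L ι H T hT)) νinf ⟨⟨φ, hφc⟩, hφs⟩ (b k)⟫_ℂ =
          ∑' k, ⟪(b' k : E), (ϖ.restrict (archProjUForm L ι H T hT)).integratedOperator (hϖ.isUnitary.restrict _)
              (hϖ.isStronglyContinuous.restrict _ (continuous_archProjUForm L ι H T hT)) νinf ⟨⟨φ, hφc⟩, hφs⟩ (b' k)⟫_ℂ := by
  intro hν x E _ _ _ ϖ hϖ φ hφc hφs κ₀ e he κ b
  exact traceClass_clauses_of_summable_norm_apply e _ he κ b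

end Literature.NumberTheory.Automorphic.UnitaryGroup

end
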